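import Literature.AlgebraicGeometry.HodgeTheory.BettiKunnethPieceAlgebraicSpanCriteria
import HarnessLib

/-!
# The rank of the correspondence representation of a Künneth piece: `dim_ℂ ⟨(v ⊗ 1)_* : v ∈ Hdgᶜ(H^{2c}(Y × Z))⟩ = dim_ℚ Hdgᶜ(HⁱY ⊗ HʲZ) = dim_ℚ Hom_HS(HⁱY, HʲZ(c − i))`, the algebraic sub-span,
# and the numeric criteria `HC(Y × Z) ⟺ dim_ℚ Hom_HS ≤ dim_ℂ ⟨algebraic actions⟩` piece by piece, `HC(X × X) ⟺ dim_ℚ End_HS(HⁿX) ≤ dim_ℂ ⟨actions of algebraic self-correspondences⟩`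
# (Voisin I §11.3.3 Thm. 11.40, Lemma 11.41, pp. 286–287; Voisin II (10.7); Voisin 2025 §3.2.1; Deligne 2000 §1)

Family `hodge`, lane `lit-hodgefound` (Track 2 foundations library; Layers A1/A4), layer `Literature/AlgebraicGeometry/HodgeTheory`.  THEOREMS ONLY (no definition, no named fact, no instance;
D-0026 net debt `0`).  Sequel of the seat's g30-#1/#2/#3.  For smooth projective `Y` (dimension `m`), `Z` (dimension `n`), a Künneth piece `Hⁱ(Y) ⊗ Hʲ(Z) ⊂ H^{2c}(Y × Z)` and the degree `a` with
`a + 2c = i + 2n` (so `a + j = 2n`), consider the ℂ-SPANS of correspondence actions `Hᵃ(Z;ℂ) → Hⁱ(Y;ℂ)`: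
the HODGE span `HS = ⟨(v ⊗ 1)_* : v ∈ Hdgᶜ(H^{2c}(Y × Z))⟩` and the ALGEBRAIC span `AS = ⟨(γ ⊗ 1)_* : γ ∈ H^{2c}(Y × Z;ℚ), γ ⊗ 1 ∈ Nᶜ(Y × Z)⟩`.  Since on `Hᵃ(Z;ℂ)` only the `(i, j)`-Künneth component
acts (g30-#1 §1), `HS` is spanned by the actions of the cross products of a ℚ-basis of `Hdgᶜ(HⁱY ⊗ HʲZ)`, which act ℂ-independently (g30-#2 §3): **`dim_ℂ HS = dim_ℚ Hdgᶜ(HⁱY ⊗ HʲZ)`**, which is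
`dim_ℚ Hom_HS(HⁱY, HʲZ(c − i))` by Lemma 11.41 — the morphisms of Hodge structures are «seen» exactly by the actions of Hodge classes.  `AS ⊆ HS` (algebraic classes are Hodge classes, Prop. 11.20), and
for `Y` off-middle algebraic with `HC(Y)`, `HC(Z)` the piece `Hᵐ(Y) ⊗ Hʲ(Z)` is algebraic iff `HS ⊆ AS` (g30-#3 span criterion and its trivial converse), i.e. iff `dim_ℚ Hom_HS(HᵐY, HʲZ(c − m)) ≤ dim_ℂ AS`:
a NUMERIC criterion — count independent actions of algebraic correspondences and compare with the dimension of the space of morphisms of Hodge structures.  Hence `HC(Y × Z)` iff this holds for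
every piece `(m, j)`, `1 ≤ j ≤ n`, and **`HC(X × X) ⟺ dim_ℚ End_HS(HⁿX) ≤ dim_ℂ ⟨actions on Hⁿ(X;ℂ) of the algebraic self-correspondences of X⟩`** for `X` off-middle algebraic with `HC(X)`
(«`End_HS(HⁿX)` is generated by algebraic correspondences»).

WHAT IS PROVED.
* §1 (any `Y`, `Z`) **`BettiUniverse.finrank_span_corrAction_hodgeClasses_eq`** (`dim_ℂ HS = dim_ℚ Hdgᶜ(HⁱY ⊗ HʲZ)`), **`…_eq_finrank_hom_tateTwist`** (`= dim_ℚ Hom_HS(HⁱY, HʲZ(c − i))`), with the two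
  inequalities **`BettiUniverse.span_corrAction_hodgeClasses_le_span_range`** / **`BettiUniverse.card_le_finrank_span_corrAction_hodgeClasses`**-type lemmas.
* §2 (any `Y`, `Z`) **`BettiUniverse.span_corrAction_algebraic_le_span_corrAction_hodgeClasses`** (`AS ≤ HS`), **`BettiUniverse.finrank_span_corrAction_algebraic_le`** (`dim_ℂ AS ≤ dim_ℚ Hdgᶜ(HⁱY ⊗ HʲZ)`).
* §3 (one factor off-middle algebraic) **`BettiUniverse.kunneth_piece_algebraic_iff_span_le_left`** / `…_right` (piece algebraic ⟺ `HS ≤ AS`), **`BettiUniverse.kunneth_piece_algebraic_iff_finrank_le_left`** /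
  `…_right` (⟺ `dim_ℚ Hdgᶜ ≤ dim_ℂ AS`).
* §4 **`BettiUniverse.hodgeConjectureFor_tensor_iff_forall_finrank_le_left`** / `…_right`; both factors off-middle algebraic **`BettiUniverse.hodgeConjectureFor_tensor_of_offMiddle_algebraic_iff_finrank_le`**
  and its Hom form **`…_iff_finrank_hom_le`**; the square **`BettiUniverse.hodgeConjectureFor_tensor_self_of_offMiddle_algebraic_iff_finrank_end_le`** (`HC(X × X) ⟺ dim_ℚ End_HS(HⁿX) ≤ dim_ℂ AS`).
* §5 odd-dimensional smooth hypersurfaces: **`IsSmoothHypersurface.hodgeConjectureFor_tensor_self_iff_finrank_end_le_of_odd`**, **`IsSmoothHypersurface.hodgeConjectureFor_tensor_hypersurface_iff_finrank_hom_le_of_odd_of_odd`**.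

THE PRINTS.  C. Voisin (2002) [VoisinHodgeI2002] §11.1.2 Prop. 11.20; §11.3.3 Thm. 11.38–11.40, Lemma 11.41 and pp. 286–287.  C. Voisin (2003) [VoisinHodgeII2003] §1.2.3 Cor. 1.24–1.25; §10.2.2 proof of Thm. 10.17,
(10.7).  C. Voisin (2025) [Voisin2025] §3.2.1 (12)–(14), Prop. 3.8, Cor. 3.9.  W. Fulton (1998) [Fulton1998] §16.1 Def. 16.1.2.  P. Deligne (2000/2006) [Deligne2000] §1.  A. Hatcher (2002) [HatcherAT2002] §3.1
p. 198, §3.3 Prop. 3.38.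

THE OBJECTS (all the tree's).  `corrAction μ hY hZ hab`, `BettiUniverse.crossMap`, `BettiUniverse.kunnethSummand`, `BettiUniverse.hodge hHD hX k`, `hodgeClasses`, `HodgeStructure.Hom`, `tensor`, `tateTwist`,
`cast`, `bettiCohomology`, `complexBetti`, `ofRatClass`, `algebraicClasses`, `HodgeConjectureFor`, `IsSmoothHypersurface`; the spans are written inline with `Submodule.span ℂ`.

DEVIATIONS / SCOPE.  The spans are not given names (no definitions); each statement spells them out.  No definitions.

## References
* [VoisinHodgeI2002] C. Voisin, *Hodge Theory and Complex Algebraic Geometry I* (2002) — §11.1.2 Prop. 11.20; §11.3.3 Thm. 11.38, Thm. 11.40, Lemma 11.41, pp. 286–287.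
* [VoisinHodgeII2003] C. Voisin, *Hodge Theory and Complex Algebraic Geometry II* (2003) — §1.2.3 Cor. 1.24–1.25; §10.2.2 proof of Thm. 10.17 (10.7).
* [Voisin2025] C. Voisin, *Cycle classes on algebraic varieties* (2025) — §3.2.1 (12)–(14), Prop. 3.8, Cor. 3.9.
* [Fulton1998] W. Fulton, *Intersection Theory* (2nd ed., 1998) — §16.1 Def. 16.1.2.
* [Deligne2000] P. Deligne, *The Hodge conjecture* (Clay problem description) — §1.
* [HatcherAT2002] A. Hatcher, *Algebraic Topology* (2002) — §3.1 p. 198; §3.3 Prop. 3.38.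

## Provenance
Lane `lit-hodgefound` (Hodge path, Track 2), prover seat `lit-hodgefound-p29` (generation 30), self-proposed row g30-#4 (sequel of g30-#1/#2/#3).
-/

noncomputable section

open scoped TensorProduct
open CategoryTheory MonoidalCategory CartesianMonoidalCategory Module Finset
open Literature.AlgebraicTopology.SingularHomology
open Literature.Geometry.Kaehler

namespace Literature.AlgebraicGeometry.HodgeTheory

open Literature.AlgebraicGeometry.Motives
open Literature.AlgebraicGeometry.Motives.HodgeStructure

variable {m n d : ℕ} {X Y Z : SchemeOver ℂ}

/-! ### §0 Plumbing -/

/-- `(q • a) ⊗ 1 = q • (a ⊗ 1)` for the lattice map `Hᵏ(Y;ℚ) → Hᵏ(Y;ℂ)` (private copy of the tree's file-local lemma). [cite: HatcherAT2002, §3.1 p. 198] -/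
private theorem ofRatClass_rat_smul' {T : Type} [TopologicalSpace T] {k : ℕ} (q : ℚ) (a : singularCohomology ℚ ℚ T k) :
    ofRatClass T k (q • a) = (q : ℂ) • ofRatClass T k a := by
  rw [ofRatClass, coeffClass_smul, smul_coeffClass]
  refine coeffClass_congr (fun x ↦ ?_) a
  simp

/-- The space of ℂ-linear maps `Hᵃ(Z;ℂ) → Hⁱ(Y;ℂ)` is finite-dimensional. [cite: VoisinHodgeI2002, §7.1.1] -/
private theorem finite_hom_complexBetti (hY : IsSmoothProjective m Y) (hZ : IsSmoothProjective n Z) (i a : ℕ) : Module.Finite ℂ (complexBetti Z a →ₗ[ℂ] complexBetti Y i) := by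
  haveI := finite_complexBetti hZ a
  haveI := finite_complexBetti hY i
  infer_instance

/-! ### §1 The Hodge span has dimension `dim_ℚ Hdgᶜ(HⁱY ⊗ HʲZ)` -/

section HodgeSpan

variable [HodgeTensorFacts.{0, 0}] (μ : OrientationFamily)

/-- **`HS` is spanned by the actions of the cross products of a ℚ-basis of `Hdgᶜ(HⁱY ⊗ HʲZ)`**: the action of a Hodge class `v` of `H^{2c}(Y × Z)` on `Hᵃ(Z;ℂ)` is the action of its `(i, j)`-Künneth
component (g30-#1 §1), a ℚ-combination of the basis. [cite: VoisinHodgeI2002, §11.3.3 Thm. 11.38–11.40 and p. 286] [cite: Voisin2025, §3.2.1 (12)–(14)] -/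
theorem BettiUniverse.span_corrAction_hodgeClasses_le_span_range {ι : Type} [Fintype ι] (hHD : exists_isReal_hodgeModel) (hY : IsSmoothProjective m Y) (hZ : IsSmoothProjective n Z)
    (hYZ : IsSmoothProjective d (Y ⊗ Z)) {c i j a : ℕ} (hij : i + j = 2 * c) (hab : a + 2 * c = i + 2 * n)
    (β : Module.Basis ι ℚ ↥(((BettiUniverse.hodge hHD hY i).tensor (BettiUniverse.hodge hHD hZ j)).hodgeClasses (c : ℤ))) :
    Submodule.span ℂ ((fun v ↦ corrAction μ hY hZ hab (ofRatClass (ComplexPoints (Y ⊗ Z)) (2 * c) v)) '' ((BettiUniverse.hodge hHD hYZ (2 * c)).hodgeClasses c : Set (bettiCohomology (Y ⊗ Z) (2 * c)))) ≤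
      Submodule.span ℂ (Set.range fun k ↦ corrAction μ hY hZ hab (ofRatClass (ComplexPoints (Y ⊗ Z)) (2 * c)
        (BettiUniverse.crossMap Y Z hij ((β k : ↥(((BettiUniverse.hodge hHD hY i).tensor (BettiUniverse.hodge hHD hZ j)).hodgeClasses (c : ℤ))) : bettiCohomology Y i ⊗[ℚ] bettiCohomology Z j)))) := by
  classical
  refine Submodule.span_le.2 ?_
  rintro _ ⟨v, hv, rfl⟩
  obtain ⟨t, ht, hact⟩ := BettiUniverse.exists_kunneth_component_corrAction_eq μ hHD hY hZ hYZ hij hab hv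
  dsimp only
  rw [← hact]
  have ht' : t ∈ ((BettiUniverse.hodge hHD hY i).tensor (BettiUniverse.hodge hHD hZ j)).hodgeClasses (c : ℤ) := ht
  have e := congrArg (Submodule.subtype (((BettiUniverse.hodge hHD hY i).tensor (BettiUniverse.hodge hHD hZ j)).hodgeClasses (c : ℤ))) (β.sum_repr ⟨t, ht'⟩).symm
  simp only [map_sum, map_smul, Submodule.subtype_apply] at e
  rw [e, map_sum, map_sum, map_sum]
  refine Submodule.sum_mem _ fun k _ ↦ ?_
  rw [map_smul, ofRatClass_rat_smul', map_smul]
  exact Submodule.smul_mem _ _ (Submodule.subset_span ⟨k, rfl⟩)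

/-- **`dim_ℂ HS ≤ dim_ℚ Hdgᶜ(HⁱY ⊗ HʲZ)`.** [cite: VoisinHodgeI2002, §11.3.3 Thm. 11.38–11.40, Lemma 11.41 and p. 286] -/
theorem BettiUniverse.finrank_span_corrAction_hodgeClasses_le (hHD : exists_isReal_hodgeModel) (hY : IsSmoothProjective m Y) (hZ : IsSmoothProjective n Z) (hYZ : IsSmoothProjective d (Y ⊗ Z))
    {c i j a : ℕ} (hij : i + j = 2 * c) (hab : a + 2 * c = i + 2 * n) :
    Module.finrank ℂ ↥(Submodule.span ℂ ((fun v ↦ corrAction μ hY hZ hab (ofRatClass (ComplexPoints (Y ⊗ Z)) (2 * c) v)) ''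
        ((BettiUniverse.hodge hHD hYZ (2 * c)).hodgeClasses c : Set (bettiCohomology (Y ⊗ Z) (2 * c))))) ≤
      Module.finrank ℚ ↥(((BettiUniverse.hodge hHD hY i).tensor (BettiUniverse.hodge hHD hZ j)).hodgeClasses c) := by
  classical
  haveI := BettiUniverse.finite hY i
  haveI := BettiUniverse.finite hZ j
  haveI := finite_hom_complexBetti hY hZ i a
  set H := ((BettiUniverse.hodge hHD hY i).tensor (BettiUniverse.hodge hHD hZ j)).hodgeClasses (c : ℤ)
  let β := Module.finBasis ℚ ↥H
  refine (Submodule.finrank_mono (BettiUniverse.span_corrAction_hodgeClasses_le_span_range μ hHD hY hZ hYZ hij hab β)).trans ?_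
  refine (finrank_range_le_card _).trans ?_
  simp

/-- **`dim_ℚ Hdgᶜ(HⁱY ⊗ HʲZ) ≤ dim_ℂ HS`**: the cross products of a ℚ-basis of `Hdgᶜ(HⁱY ⊗ HʲZ)` are Hodge classes of `H^{2c}(Y × Z)` acting ℂ-independently (g30-#2 §3).
[cite: VoisinHodgeI2002, §11.3.3 Thm. 11.38–11.40, Lemma 11.41 and p. 286] [cite: HatcherAT2002, §3.3 Prop. 3.38] -/
theorem BettiUniverse.le_finrank_span_corrAction_hodgeClasses (hHD : exists_isReal_hodgeModel) (hY : IsSmoothProjective m Y) (hZ : IsSmoothProjective n Z) (hYZ : IsSmoothProjective d (Y ⊗ Z))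
    {c i j a : ℕ} (hij : i + j = 2 * c) (haj : a + j = 2 * n) (hab : a + 2 * c = i + 2 * n) :
    Module.finrank ℚ ↥(((BettiUniverse.hodge hHD hY i).tensor (BettiUniverse.hodge hHD hZ j)).hodgeClasses c) ≤
      Module.finrank ℂ ↥(Submodule.span ℂ ((fun v ↦ corrAction μ hY hZ hab (ofRatClass (ComplexPoints (Y ⊗ Z)) (2 * c) v)) ''
        ((BettiUniverse.hodge hHD hYZ (2 * c)).hodgeClasses c : Set (bettiCohomology (Y ⊗ Z) (2 * c))))) := by
  classical
  haveI := finite_hom_complexBetti hY hZ i a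
  obtain ⟨v, hv, -, hind⟩ := BettiUniverse.exists_hodgeClasses_linearIndependent_corrAction μ hHD hY hZ hYZ hij haj hab
  have hle : Submodule.span ℂ (Set.range fun k ↦ corrAction μ hY hZ hab (ofRatClass (ComplexPoints (Y ⊗ Z)) (2 * c) (v k))) ≤
      Submodule.span ℂ ((fun v ↦ corrAction μ hY hZ hab (ofRatClass (ComplexPoints (Y ⊗ Z)) (2 * c) v)) ''
        ((BettiUniverse.hodge hHD hYZ (2 * c)).hodgeClasses c : Set (bettiCohomology (Y ⊗ Z) (2 * c)))) :=
    Submodule.span_mono (Set.range_subset_iff.2 fun k ↦ ⟨v k, hv k, rfl⟩)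
  refine le_trans ?_ (Submodule.finrank_mono hle)
  rw [finrank_span_eq_card hind, Fintype.card_fin]

/-- **`dim_ℂ ⟨(v ⊗ 1)_* : v ∈ Hdgᶜ(H^{2c}(Y × Z))⟩ = dim_ℚ Hdgᶜ(Hⁱ(Y) ⊗ Hʲ(Z))`** (actions `Hᵃ(Z;ℂ) → Hⁱ(Y;ℂ)`, `a + 2c = i + 2n`, any `Y`, `Z`, any orientation family): the morphisms of Hodge structures of
Lemma 11.41 are seen exactly by the actions of Hodge classes. [cite: VoisinHodgeI2002, §11.3.3 Thm. 11.40, Lemma 11.41 and pp. 286–287] [cite: Voisin2025, §3.2.1 (12)–(14)] -/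
theorem BettiUniverse.finrank_span_corrAction_hodgeClasses_eq (hHD : exists_isReal_hodgeModel) (hY : IsSmoothProjective m Y) (hZ : IsSmoothProjective n Z) (hYZ : IsSmoothProjective d (Y ⊗ Z))
    {c i j a : ℕ} (hij : i + j = 2 * c) (haj : a + j = 2 * n) (hab : a + 2 * c = i + 2 * n) :
    Module.finrank ℂ ↥(Submodule.span ℂ ((fun v ↦ corrAction μ hY hZ hab (ofRatClass (ComplexPoints (Y ⊗ Z)) (2 * c) v)) ''
        ((BettiUniverse.hodge hHD hYZ (2 * c)).hodgeClasses c : Set (bettiCohomology (Y ⊗ Z) (2 * c))))) =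
      Module.finrank ℚ ↥(((BettiUniverse.hodge hHD hY i).tensor (BettiUniverse.hodge hHD hZ j)).hodgeClasses c) :=
  le_antisymm (BettiUniverse.finrank_span_corrAction_hodgeClasses_le μ hHD hY hZ hYZ hij hab) (BettiUniverse.le_finrank_span_corrAction_hodgeClasses μ hHD hY hZ hYZ hij haj hab)

/-- **Hom form: `dim_ℂ HS = dim_ℚ Hom_HS(Hⁱ(Y), Hʲ(Z)(c − i))`** (Lemma 11.41). [cite: VoisinHodgeI2002, §11.3.3 Thm. 11.40, Lemma 11.41 and pp. 286–287] -/
theorem BettiUniverse.finrank_span_corrAction_hodgeClasses_eq_finrank_hom_tateTwist (hHD : exists_isReal_hodgeModel) (hY : IsSmoothProjective m Y) (hZ : IsSmoothProjective n Z)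
    (hYZ : IsSmoothProjective d (Y ⊗ Z)) {c i j a : ℕ} (hij : i + j = 2 * c) (haj : a + j = 2 * n) (hab : a + 2 * c = i + 2 * n) (hs : (j : ℤ) - 2 * ((c : ℤ) - i) = i) :
    Module.finrank ℂ ↥(Submodule.span ℂ ((fun v ↦ corrAction μ hY hZ hab (ofRatClass (ComplexPoints (Y ⊗ Z)) (2 * c) v)) ''
        ((BettiUniverse.hodge hHD hYZ (2 * c)).hodgeClasses c : Set (bettiCohomology (Y ⊗ Z) (2 * c))))) =
      Module.finrank ℚ (HodgeStructure.Hom (BettiUniverse.hodge hHD hY i) (((BettiUniverse.hodge hHD hZ j).tateTwist ((c : ℤ) - i)).cast hs)) := by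
  have e := BettiUniverse.finrank_hodgeClasses_tensor_hodge_eq_finrank_hom_tateTwist hHD hY hZ i j (s := (c : ℤ) - i) hs
  rw [show ((i : ℕ) : ℤ) + ((c : ℤ) - i) = (c : ℤ) by ring] at e
  rw [← e]
  exact BettiUniverse.finrank_span_corrAction_hodgeClasses_eq μ hHD hY hZ hYZ hij haj hab

end HodgeSpan

/-! ### §2 The algebraic span lies inside the Hodge span -/

section AlgebraicSpan

variable [HodgeTensorFacts.{0, 0}] (μ : OrientationFamily)

omit [HodgeTensorFacts.{0, 0}] in
/-- **`AS ≤ HS`**: a rational class with algebraic complexification is a Hodge class (Prop. 11.20). [cite: VoisinHodgeI2002, §11.1.2 Prop. 11.20] -/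
theorem BettiUniverse.span_corrAction_algebraic_le_span_corrAction_hodgeClasses (hHD : exists_isReal_hodgeModel) (hY : IsSmoothProjective m Y) (hZ : IsSmoothProjective n Z)
    (hYZ : IsSmoothProjective d (Y ⊗ Z)) {c i a : ℕ} (hab : a + 2 * c = i + 2 * n) :
    Submodule.span ℂ ((fun γ ↦ corrAction μ hY hZ hab (ofRatClass (ComplexPoints (Y ⊗ Z)) (2 * c) γ)) ''
        {γ : bettiCohomology (Y ⊗ Z) (2 * c) | ofRatClass (ComplexPoints (Y ⊗ Z)) (2 * c) γ ∈ algebraicClasses (Y ⊗ Z) c}) ≤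
      Submodule.span ℂ ((fun v ↦ corrAction μ hY hZ hab (ofRatClass (ComplexPoints (Y ⊗ Z)) (2 * c) v)) ''
        ((BettiUniverse.hodge hHD hYZ (2 * c)).hodgeClasses c : Set (bettiCohomology (Y ⊗ Z) (2 * c)))) := by
  refine Submodule.span_mono ?_
  rintro _ ⟨γ, hγ, rfl⟩
  exact ⟨γ, (BettiUniverse.mem_hodgeClasses_hodge_iff_isOfHodgeType hHD hYZ c γ).2 (isOfHodgeType_of_mem_algebraicClasses_of_isSmoothProjective hYZ c hγ), rfl⟩

/-- **`dim_ℂ AS ≤ dim_ℚ Hdgᶜ(Hⁱ(Y) ⊗ Hʲ(Z))`** (`AS ≤ HS` and §1). [cite: VoisinHodgeI2002, §11.1.2 Prop. 11.20, §11.3.3 Lemma 11.41 and p. 286] -/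
theorem BettiUniverse.finrank_span_corrAction_algebraic_le (hHD : exists_isReal_hodgeModel) (hY : IsSmoothProjective m Y) (hZ : IsSmoothProjective n Z) {c i j a : ℕ} (hij : i + j = 2 * c)
    (hab : a + 2 * c = i + 2 * n) :
    Module.finrank ℂ ↥(Submodule.span ℂ ((fun γ ↦ corrAction μ hY hZ hab (ofRatClass (ComplexPoints (Y ⊗ Z)) (2 * c) γ)) ''
        {γ : bettiCohomology (Y ⊗ Z) (2 * c) | ofRatClass (ComplexPoints (Y ⊗ Z)) (2 * c) γ ∈ algebraicClasses (Y ⊗ Z) c})) ≤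
      Module.finrank ℚ ↥(((BettiUniverse.hodge hHD hY i).tensor (BettiUniverse.hodge hHD hZ j)).hodgeClasses c) := by
  haveI := finite_hom_complexBetti hY hZ i a
  exact (Submodule.finrank_mono (BettiUniverse.span_corrAction_algebraic_le_span_corrAction_hodgeClasses μ hHD hY hZ (hY.tensor_holds hZ) hab)).trans
    (BettiUniverse.finrank_span_corrAction_hodgeClasses_le μ hHD hY hZ (hY.tensor_holds hZ) hij hab)

end AlgebraicSpan

/-! ### §3 One factor off-middle algebraic: the piece is algebraic iff the two spans coincide -/

section Piece

variable [HodgeTensorFacts.{0, 0}] (μ : OrientationFamily)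

/-- **(⟹, any `Y`, `Z`)** If every Hodge class of the summand `Hⁱ(Y) ⊗ Hʲ(Z)` has algebraic cross product, then `HS ≤ AS`: the action of a Hodge class of `H^{2c}(Y × Z)` on `Hᵃ(Z;ℂ)` is the action of its
`(i, j)`-component, whose cross product is rational and algebraic. [cite: VoisinHodgeI2002, §11.3.3 Thm. 11.38–11.40 and pp. 286–287] [cite: Voisin2025, §3.2.1 (12)–(14)] -/
theorem BettiUniverse.span_corrAction_hodgeClasses_le_span_corrAction_algebraic_of_forall (hHD : exists_isReal_hodgeModel) (hY : IsSmoothProjective m Y) (hZ : IsSmoothProjective n Z)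
    (hYZ : IsSmoothProjective d (Y ⊗ Z)) {c i j a : ℕ} (hij : i + j = 2 * c) (hab : a + 2 * c = i + 2 * n)
    (halg : ∀ t ∈ (BettiUniverse.kunnethSummand hHD hY hZ (2 * c) ⟨(i, j), HasAntidiagonal.mem_antidiagonal.2 hij⟩).hodgeClasses c,
      ofRatClass (ComplexPoints (Y ⊗ Z)) (2 * c) (BettiUniverse.crossMap Y Z hij t) ∈ algebraicClasses (Y ⊗ Z) c) :
    Submodule.span ℂ ((fun v ↦ corrAction μ hY hZ hab (ofRatClass (ComplexPoints (Y ⊗ Z)) (2 * c) v)) ''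
        ((BettiUniverse.hodge hHD hYZ (2 * c)).hodgeClasses c : Set (bettiCohomology (Y ⊗ Z) (2 * c)))) ≤
      Submodule.span ℂ ((fun γ ↦ corrAction μ hY hZ hab (ofRatClass (ComplexPoints (Y ⊗ Z)) (2 * c) γ)) ''
        {γ : bettiCohomology (Y ⊗ Z) (2 * c) | ofRatClass (ComplexPoints (Y ⊗ Z)) (2 * c) γ ∈ algebraicClasses (Y ⊗ Z) c}) := by
  refine Submodule.span_le.2 ?_
  rintro _ ⟨v, hv, rfl⟩
  obtain ⟨t, ht, hact⟩ := BettiUniverse.exists_kunneth_component_corrAction_eq μ hHD hY hZ hYZ hij hab hv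
  dsimp only
  rw [← hact]
  exact Submodule.subset_span ⟨_, halg t ht, rfl⟩

/-- **Piece algebraic ⟺ `HS ≤ AS` (left factor off-middle algebraic).**  Let `Y` (dimension `m`) satisfy `HC(Y)`, `Hᵏ(Y;ℚ) = 0` for odd `k ≠ m`, `Hdgᵖ(H^{2p}Y) = H^{2p}(Y;ℚ)` for `2p ≠ m`, and `Z`
(dimension `n`) satisfy `HC(Z)`.  Then every Hodge class of `Hᵐ(Y) ⊗ Hʲ(Z)` (`m + j = 2c`) has algebraic cross product iff the Hodge span of actions on `Hᵃ(Z;ℂ)` (`a + j = 2n`) lies in the algebraic span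
(⟸: g30-#3 span criterion). [cite: VoisinHodgeI2002, §11.3.3 Thm. 11.38–11.40, Lemma 11.41 and pp. 286–287] [cite: Voisin2025, §3.2.1 (12)–(14), Prop. 3.8 and Cor. 3.9] -/
theorem BettiUniverse.kunneth_piece_algebraic_iff_span_le_left (hHD : exists_isReal_hodgeModel) (hY : IsSmoothProjective m Y) (hZ : IsSmoothProjective n Z) (hYZ : IsSmoothProjective d (Y ⊗ Z))
    (hHCY : HodgeConjectureFor m Y) (hHCZ : HodgeConjectureFor n Z) (hodd : ∀ k, Odd k → k ≠ m → Module.finrank ℚ (bettiCohomology Y k) = 0)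
    (heven : ∀ p, 2 * p ≠ m → (BettiUniverse.hodge hHD hY (2 * p)).hodgeClasses p = ⊤) {c j a : ℕ} (hmj : m + j = 2 * c) (haj : a + j = 2 * n) (hab : a + 2 * c = m + 2 * n) :
    (∀ t ∈ (BettiUniverse.kunnethSummand hHD hY hZ (2 * c) ⟨(m, j), HasAntidiagonal.mem_antidiagonal.2 hmj⟩).hodgeClasses c,
        ofRatClass (ComplexPoints (Y ⊗ Z)) (2 * c) (BettiUniverse.crossMap Y Z hmj t) ∈ algebraicClasses (Y ⊗ Z) c) ↔
      Submodule.span ℂ ((fun v ↦ corrAction μ hY hZ hab (ofRatClass (ComplexPoints (Y ⊗ Z)) (2 * c) v)) ''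
          ((BettiUniverse.hodge hHD hYZ (2 * c)).hodgeClasses c : Set (bettiCohomology (Y ⊗ Z) (2 * c)))) ≤
        Submodule.span ℂ ((fun γ ↦ corrAction μ hY hZ hab (ofRatClass (ComplexPoints (Y ⊗ Z)) (2 * c) γ)) ''
          {γ : bettiCohomology (Y ⊗ Z) (2 * c) | ofRatClass (ComplexPoints (Y ⊗ Z)) (2 * c) γ ∈ algebraicClasses (Y ⊗ Z) c}) := by
  refine ⟨BettiUniverse.span_corrAction_hodgeClasses_le_span_corrAction_algebraic_of_forall μ hHD hY hZ hYZ hmj hab, fun hle t ht ↦ ?_⟩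
  refine BettiUniverse.ofRatClass_crossMap_mem_algebraicClasses_of_corrAction_mem_span_left μ hHD hY hZ hHCY hHCZ hodd heven hmj haj hab (hle ?_)
  exact Submodule.subset_span ⟨_, BettiUniverse.crossMap_mem_hodgeClasses hHD hodgePQ_independent_of_hodgeModel_holds hY hZ hYZ hmj c ht, rfl⟩

/-- **NUMERIC CRITERION (left factor off-middle algebraic): the piece `Hᵐ(Y) ⊗ Hʲ(Z)` is algebraic iff `dim_ℚ Hdgᶜ(HᵐY ⊗ HʲZ) ≤ dim_ℂ AS`** (`AS ≤ HS` of dimension `dim_ℚ Hdgᶜ(HᵐY ⊗ HʲZ)`, so the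
inequality forces `AS = HS`). [cite: VoisinHodgeI2002, §11.3.3 Thm. 11.38–11.40, Lemma 11.41 and pp. 286–287] [cite: Voisin2025, §3.2.1 (12)–(14), Prop. 3.8 and Cor. 3.9] -/
theorem BettiUniverse.kunneth_piece_algebraic_iff_finrank_le_left (hHD : exists_isReal_hodgeModel) (hY : IsSmoothProjective m Y) (hZ : IsSmoothProjective n Z)
    (hHCY : HodgeConjectureFor m Y) (hHCZ : HodgeConjectureFor n Z) (hodd : ∀ k, Odd k → k ≠ m → Module.finrank ℚ (bettiCohomology Y k) = 0)
    (heven : ∀ p, 2 * p ≠ m → (BettiUniverse.hodge hHD hY (2 * p)).hodgeClasses p = ⊤) {c j a : ℕ} (hmj : m + j = 2 * c) (haj : a + j = 2 * n) (hab : a + 2 * c = m + 2 * n) :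
    (∀ t ∈ (BettiUniverse.kunnethSummand hHD hY hZ (2 * c) ⟨(m, j), HasAntidiagonal.mem_antidiagonal.2 hmj⟩).hodgeClasses c,
        ofRatClass (ComplexPoints (Y ⊗ Z)) (2 * c) (BettiUniverse.crossMap Y Z hmj t) ∈ algebraicClasses (Y ⊗ Z) c) ↔
      Module.finrank ℚ ↥(((BettiUniverse.hodge hHD hY m).tensor (BettiUniverse.hodge hHD hZ j)).hodgeClasses c) ≤
        Module.finrank ℂ ↥(Submodule.span ℂ ((fun γ ↦ corrAction μ hY hZ hab (ofRatClass (ComplexPoints (Y ⊗ Z)) (2 * c) γ)) ''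
          {γ : bettiCohomology (Y ⊗ Z) (2 * c) | ofRatClass (ComplexPoints (Y ⊗ Z)) (2 * c) γ ∈ algebraicClasses (Y ⊗ Z) c})) := by
  haveI := finite_hom_complexBetti hY hZ m a
  have hYZ := hY.tensor_holds hZ
  have hAS := BettiUniverse.span_corrAction_algebraic_le_span_corrAction_hodgeClasses μ hHD hY hZ hYZ (c := c) hab
  have hdim := BettiUniverse.finrank_span_corrAction_hodgeClasses_eq μ hHD hY hZ hYZ hmj haj hab
  rw [BettiUniverse.kunneth_piece_algebraic_iff_span_le_left μ hHD hY hZ hYZ hHCY hHCZ hodd heven hmj haj hab]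
  constructor
  · intro hle
    rw [← hdim]
    exact Submodule.finrank_mono hle
  · intro hle
    rw [← hdim] at hle
    exact (Submodule.eq_of_le_of_finrank_le hAS hle).ge

/-- **Piece algebraic ⟺ `HS ≤ AS` (right factor off-middle algebraic)**, actions on `Hⁿ(Z;ℂ)`, piece `Hⁱ(Y) ⊗ Hⁿ(Z)`. [cite: VoisinHodgeI2002, §11.3.3 Thm. 11.38–11.40, Lemma 11.41 and pp. 286–287]
[cite: Voisin2025, §3.2.1 (12)–(14), Prop. 3.8 and Cor. 3.9] -/
theorem BettiUniverse.kunneth_piece_algebraic_iff_span_le_right (hHD : exists_isReal_hodgeModel) (hY : IsSmoothProjective m Y) (hZ : IsSmoothProjective n Z) (hYZ : IsSmoothProjective d (Y ⊗ Z))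
    (hHCY : HodgeConjectureFor m Y) (hHCZ : HodgeConjectureFor n Z) (hodd : ∀ k, Odd k → k ≠ n → Module.finrank ℚ (bettiCohomology Z k) = 0)
    (heven : ∀ p, 2 * p ≠ n → (BettiUniverse.hodge hHD hZ (2 * p)).hodgeClasses p = ⊤) {c i : ℕ} (hin : i + n = 2 * c) (hab : n + 2 * c = i + 2 * n) :
    (∀ t ∈ (BettiUniverse.kunnethSummand hHD hY hZ (2 * c) ⟨(i, n), HasAntidiagonal.mem_antidiagonal.2 hin⟩).hodgeClasses c,
        ofRatClass (ComplexPoints (Y ⊗ Z)) (2 * c) (BettiUniverse.crossMap Y Z hin t) ∈ algebraicClasses (Y ⊗ Z) c) ↔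
      Submodule.span ℂ ((fun v ↦ corrAction μ hY hZ hab (ofRatClass (ComplexPoints (Y ⊗ Z)) (2 * c) v)) ''
          ((BettiUniverse.hodge hHD hYZ (2 * c)).hodgeClasses c : Set (bettiCohomology (Y ⊗ Z) (2 * c)))) ≤
        Submodule.span ℂ ((fun γ ↦ corrAction μ hY hZ hab (ofRatClass (ComplexPoints (Y ⊗ Z)) (2 * c) γ)) ''
          {γ : bettiCohomology (Y ⊗ Z) (2 * c) | ofRatClass (ComplexPoints (Y ⊗ Z)) (2 * c) γ ∈ algebraicClasses (Y ⊗ Z) c}) := by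
  refine ⟨BettiUniverse.span_corrAction_hodgeClasses_le_span_corrAction_algebraic_of_forall μ hHD hY hZ hYZ hin hab, fun hle t ht ↦ ?_⟩
  refine BettiUniverse.ofRatClass_crossMap_mem_algebraicClasses_of_corrAction_mem_span_right μ hHD hY hZ hHCY hHCZ hodd heven hin hab (hle ?_)
  exact Submodule.subset_span ⟨_, BettiUniverse.crossMap_mem_hodgeClasses hHD hodgePQ_independent_of_hodgeModel_holds hY hZ hYZ hin c ht, rfl⟩

/-- **NUMERIC CRITERION (right factor off-middle algebraic).** [cite: VoisinHodgeI2002, §11.3.3 Thm. 11.38–11.40, Lemma 11.41 and pp. 286–287] [cite: Voisin2025, §3.2.1 (12)–(14), Prop. 3.8 and Cor. 3.9] -/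
theorem BettiUniverse.kunneth_piece_algebraic_iff_finrank_le_right (hHD : exists_isReal_hodgeModel) (hY : IsSmoothProjective m Y) (hZ : IsSmoothProjective n Z)
    (hHCY : HodgeConjectureFor m Y) (hHCZ : HodgeConjectureFor n Z) (hodd : ∀ k, Odd k → k ≠ n → Module.finrank ℚ (bettiCohomology Z k) = 0)
    (heven : ∀ p, 2 * p ≠ n → (BettiUniverse.hodge hHD hZ (2 * p)).hodgeClasses p = ⊤) {c i : ℕ} (hin : i + n = 2 * c) (hab : n + 2 * c = i + 2 * n) :
    (∀ t ∈ (BettiUniverse.kunnethSummand hHD hY hZ (2 * c) ⟨(i, n), HasAntidiagonal.mem_antidiagonal.2 hin⟩).hodgeClasses c,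
        ofRatClass (ComplexPoints (Y ⊗ Z)) (2 * c) (BettiUniverse.crossMap Y Z hin t) ∈ algebraicClasses (Y ⊗ Z) c) ↔
      Module.finrank ℚ ↥(((BettiUniverse.hodge hHD hY i).tensor (BettiUniverse.hodge hHD hZ n)).hodgeClasses c) ≤
        Module.finrank ℂ ↥(Submodule.span ℂ ((fun γ ↦ corrAction μ hY hZ hab (ofRatClass (ComplexPoints (Y ⊗ Z)) (2 * c) γ)) ''
          {γ : bettiCohomology (Y ⊗ Z) (2 * c) | ofRatClass (ComplexPoints (Y ⊗ Z)) (2 * c) γ ∈ algebraicClasses (Y ⊗ Z) c})) := by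
  haveI := finite_hom_complexBetti hY hZ i n
  have hYZ := hY.tensor_holds hZ
  have hAS := BettiUniverse.span_corrAction_algebraic_le_span_corrAction_hodgeClasses μ hHD hY hZ hYZ (c := c) hab
  have hdim := BettiUniverse.finrank_span_corrAction_hodgeClasses_eq μ hHD hY hZ hYZ hin (two_mul n).symm hab
  rw [BettiUniverse.kunneth_piece_algebraic_iff_span_le_right μ hHD hY hZ hYZ hHCY hHCZ hodd heven hin hab]
  constructor
  · intro hle
    rw [← hdim]
    exact Submodule.finrank_mono hle
  · intro hle
    rw [← hdim] at hle
    exact (Submodule.eq_of_le_of_finrank_le hAS hle).ge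

end Piece

/-! ### §4 `HC(Y × Z)` as a numeric criterion -/

section Criteria

variable [HodgeTensorFacts.{0, 0}] (μ : OrientationFamily)

/-- **`HC(Y × Z) ⟺` for every piece `Hᵐ(Y) ⊗ Hʲ(Z)`, `1 ≤ j ≤ n`: `dim_ℚ Hdgᶜ(HᵐY ⊗ HʲZ) ≤ dim_ℂ ⟨actions on H^{2n−j}(Z;ℂ) of the rational algebraic classes of H^{2c}(Y × Z)⟩`** (`Y` off-middle algebraic
with `HC(Y)`, `HC(Z)`). [cite: VoisinHodgeI2002, §11.3.3 Thm. 11.38–11.40, Lemma 11.41 and pp. 286–287] [cite: Voisin2025, §3.2.1 (12)–(14), Prop. 3.8 and Cor. 3.9] [cite: Deligne2000, §1] -/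
theorem BettiUniverse.hodgeConjectureFor_tensor_iff_forall_finrank_le_left (hHD : exists_isReal_hodgeModel) (hY : IsSmoothProjective m Y) (hZ : IsSmoothProjective n Z) (hYZ : IsSmoothProjective d (Y ⊗ Z))
    (hHCY : HodgeConjectureFor m Y) (hHCZ : HodgeConjectureFor n Z) (hodd : ∀ k, Odd k → k ≠ m → Module.finrank ℚ (bettiCohomology Y k) = 0)
    (heven : ∀ p, 2 * p ≠ m → (BettiUniverse.hodge hHD hY (2 * p)).hodgeClasses p = ⊤) :
    HodgeConjectureFor d (Y ⊗ Z) ↔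
      ∀ (c j a : ℕ) (hmj : m + j = 2 * c) (hab : a + 2 * c = m + 2 * n), 1 ≤ j → j ≤ n →
        Module.finrank ℚ ↥(((BettiUniverse.hodge hHD hY m).tensor (BettiUniverse.hodge hHD hZ j)).hodgeClasses c) ≤
          Module.finrank ℂ ↥(Submodule.span ℂ ((fun γ ↦ corrAction μ hY hZ hab (ofRatClass (ComplexPoints (Y ⊗ Z)) (2 * c) γ)) ''
            {γ : bettiCohomology (Y ⊗ Z) (2 * c) | ofRatClass (ComplexPoints (Y ⊗ Z)) (2 * c) γ ∈ algebraicClasses (Y ⊗ Z) c})) := by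
  constructor
  · intro hHC c j a hmj hab _ _
    rw [← BettiUniverse.kunneth_piece_algebraic_iff_finrank_le_left μ hHD hY hZ hHCY hHCZ hodd heven hmj (by omega) hab]
    intro t ht
    obtain ⟨γ, hγ, hact⟩ := BettiUniverse.forall_exists_corrAction_eq_of_hodgeConjectureFor_tensor μ hHD hY hZ hYZ hHC hmj hab ht
    exact BettiUniverse.ofRatClass_crossMap_mem_algebraicClasses_of_corrAction_eq_left μ hHD hY hZ hHCY hHCZ hodd heven hmj (by omega) hab hγ hact
  · intro h
    refine BettiUniverse.hodgeConjectureFor_tensor_of_offMiddle_algebraic_left hHD hY hZ hYZ hHCY hHCZ hodd heven fun c j hmj hj1 hjn t ht ↦ ?_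
    exact (BettiUniverse.kunneth_piece_algebraic_iff_finrank_le_left μ hHD hY hZ hHCY hHCZ hodd heven hmj (show 2 * n - j + j = 2 * n by omega) (by omega)).2
      (h c j (2 * n - j) hmj (by omega) hj1 hjn) t ht

/-- **`HC(Y × Z) ⟺` the numeric criterion on every piece `Hⁱ(Y) ⊗ Hⁿ(Z)`, `1 ≤ i ≤ m`** (`Z` off-middle algebraic with `HC(Z)`, `HC(Y)`; actions on `Hⁿ(Z;ℂ)`).
[cite: VoisinHodgeI2002, §11.3.3 Thm. 11.38–11.40, Lemma 11.41 and pp. 286–287] [cite: Voisin2025, §3.2.1 (12)–(14), Prop. 3.8 and Cor. 3.9] [cite: Deligne2000, §1] -/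
theorem BettiUniverse.hodgeConjectureFor_tensor_iff_forall_finrank_le_right (hHD : exists_isReal_hodgeModel) (hY : IsSmoothProjective m Y) (hZ : IsSmoothProjective n Z) (hYZ : IsSmoothProjective d (Y ⊗ Z))
    (hHCY : HodgeConjectureFor m Y) (hHCZ : HodgeConjectureFor n Z) (hodd : ∀ k, Odd k → k ≠ n → Module.finrank ℚ (bettiCohomology Z k) = 0)
    (heven : ∀ p, 2 * p ≠ n → (BettiUniverse.hodge hHD hZ (2 * p)).hodgeClasses p = ⊤) :
    HodgeConjectureFor d (Y ⊗ Z) ↔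
      ∀ (c i : ℕ) (hin : i + n = 2 * c) (hab : n + 2 * c = i + 2 * n), 1 ≤ i → i ≤ m →
        Module.finrank ℚ ↥(((BettiUniverse.hodge hHD hY i).tensor (BettiUniverse.hodge hHD hZ n)).hodgeClasses c) ≤
          Module.finrank ℂ ↥(Submodule.span ℂ ((fun γ ↦ corrAction μ hY hZ hab (ofRatClass (ComplexPoints (Y ⊗ Z)) (2 * c) γ)) ''
            {γ : bettiCohomology (Y ⊗ Z) (2 * c) | ofRatClass (ComplexPoints (Y ⊗ Z)) (2 * c) γ ∈ algebraicClasses (Y ⊗ Z) c})) := by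
  constructor
  · intro hHC c i hin hab _ _
    rw [← BettiUniverse.kunneth_piece_algebraic_iff_finrank_le_right μ hHD hY hZ hHCY hHCZ hodd heven hin hab]
    intro t ht
    obtain ⟨γ, hγ, hact⟩ := BettiUniverse.forall_exists_corrAction_eq_of_hodgeConjectureFor_tensor μ hHD hY hZ hYZ hHC hin hab ht
    exact BettiUniverse.ofRatClass_crossMap_mem_algebraicClasses_of_corrAction_eq_right μ hHD hY hZ hHCY hHCZ hodd heven hin hab hγ hact
  · intro h
    refine BettiUniverse.hodgeConjectureFor_tensor_of_offMiddle_algebraic_right hHD hY hZ hYZ hHCY hHCZ hodd heven fun c i hin hi1 him t ht ↦ ?_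
    exact (BettiUniverse.kunneth_piece_algebraic_iff_finrank_le_right μ hHD hY hZ hHCY hHCZ hodd heven hin (by omega)).2 (h c i hin (by omega) hi1 him) t ht

/-- **Both factors off-middle algebraic: `HC(Y × Z) ⟺ dim_ℚ Hdgᶜ(HᵐY ⊗ HⁿZ) ≤ dim_ℂ ⟨actions on Hⁿ(Z;ℂ) of the rational algebraic classes of H^{2c}(Y × Z)⟩`** (`m + n = 2c`).
[cite: VoisinHodgeI2002, §11.3.3 Thm. 11.38–11.40, Lemma 11.41 and pp. 286–287] [cite: Voisin2025, §3.2.1 (12)–(14), Prop. 3.8 and Cor. 3.9] [cite: Deligne2000, §1] -/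
theorem BettiUniverse.hodgeConjectureFor_tensor_of_offMiddle_algebraic_iff_finrank_le (hHD : exists_isReal_hodgeModel) (hY : IsSmoothProjective m Y) (hZ : IsSmoothProjective n Z)
    (hYZ : IsSmoothProjective d (Y ⊗ Z)) (hHCY : HodgeConjectureFor m Y) (hHCZ : HodgeConjectureFor n Z)
    (hoddY : ∀ k, Odd k → k ≠ m → Module.finrank ℚ (bettiCohomology Y k) = 0) (hevenY : ∀ p, 2 * p ≠ m → (BettiUniverse.hodge hHD hY (2 * p)).hodgeClasses p = ⊤)
    (hoddZ : ∀ k, Odd k → k ≠ n → Module.finrank ℚ (bettiCohomology Z k) = 0) (hevenZ : ∀ p, 2 * p ≠ n → (BettiUniverse.hodge hHD hZ (2 * p)).hodgeClasses p = ⊤)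
    {c : ℕ} (hmn : m + n = 2 * c) (hab : n + 2 * c = m + 2 * n) :
    HodgeConjectureFor d (Y ⊗ Z) ↔
      Module.finrank ℚ ↥(((BettiUniverse.hodge hHD hY m).tensor (BettiUniverse.hodge hHD hZ n)).hodgeClasses c) ≤
        Module.finrank ℂ ↥(Submodule.span ℂ ((fun γ ↦ corrAction μ hY hZ hab (ofRatClass (ComplexPoints (Y ⊗ Z)) (2 * c) γ)) ''
          {γ : bettiCohomology (Y ⊗ Z) (2 * c) | ofRatClass (ComplexPoints (Y ⊗ Z)) (2 * c) γ ∈ algebraicClasses (Y ⊗ Z) c})) := by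
  rw [BettiUniverse.hodgeConjectureFor_tensor_of_offMiddle_algebraic_iff_forall_exists_corrAction_eq μ hHD hY hZ hYZ hHCY hHCZ hoddY hevenY hoddZ hevenZ hmn hab,
    ← BettiUniverse.kunneth_piece_algebraic_iff_finrank_le_left μ hHD hY hZ hHCY hHCZ hoddY hevenY hmn (two_mul n).symm hab]
  refine ⟨fun h t ht ↦ ?_, fun h t ht ↦ ⟨_, h t ht, rfl⟩⟩
  obtain ⟨γ, hγ, hact⟩ := h t ht
  exact BettiUniverse.ofRatClass_crossMap_mem_algebraicClasses_of_corrAction_eq_left μ hHD hY hZ hHCY hHCZ hoddY hevenY hmn (two_mul n).symm hab hγ hact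

/-- **Hom form**: `HC(Y × Z) ⟺ dim_ℚ Hom_HS(Hᵐ(Y), Hⁿ(Z)(c − m)) ≤ dim_ℂ AS` (both factors off-middle algebraic, `m + n = 2c`; Lemma 11.41). [cite: VoisinHodgeI2002, §11.3.3 Thm. 11.40, Lemma 11.41 and pp. 286–287]
[cite: Deligne2000, §1] -/
theorem BettiUniverse.hodgeConjectureFor_tensor_of_offMiddle_algebraic_iff_finrank_hom_le (hHD : exists_isReal_hodgeModel) (hY : IsSmoothProjective m Y) (hZ : IsSmoothProjective n Z)
    (hYZ : IsSmoothProjective d (Y ⊗ Z)) (hHCY : HodgeConjectureFor m Y) (hHCZ : HodgeConjectureFor n Z)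
    (hoddY : ∀ k, Odd k → k ≠ m → Module.finrank ℚ (bettiCohomology Y k) = 0) (hevenY : ∀ p, 2 * p ≠ m → (BettiUniverse.hodge hHD hY (2 * p)).hodgeClasses p = ⊤)
    (hoddZ : ∀ k, Odd k → k ≠ n → Module.finrank ℚ (bettiCohomology Z k) = 0) (hevenZ : ∀ p, 2 * p ≠ n → (BettiUniverse.hodge hHD hZ (2 * p)).hodgeClasses p = ⊤)
    {c : ℕ} (hmn : m + n = 2 * c) (hab : n + 2 * c = m + 2 * n) (hs : (n : ℤ) - 2 * ((c : ℤ) - m) = m) :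
    HodgeConjectureFor d (Y ⊗ Z) ↔
      Module.finrank ℚ (HodgeStructure.Hom (BettiUniverse.hodge hHD hY m) (((BettiUniverse.hodge hHD hZ n).tateTwist ((c : ℤ) - m)).cast hs)) ≤
        Module.finrank ℂ ↥(Submodule.span ℂ ((fun γ ↦ corrAction μ hY hZ hab (ofRatClass (ComplexPoints (Y ⊗ Z)) (2 * c) γ)) ''
          {γ : bettiCohomology (Y ⊗ Z) (2 * c) | ofRatClass (ComplexPoints (Y ⊗ Z)) (2 * c) γ ∈ algebraicClasses (Y ⊗ Z) c})) := by
  have e := BettiUniverse.finrank_hodgeClasses_tensor_hodge_eq_finrank_hom_tateTwist hHD hY hZ m n (s := (c : ℤ) - m) hs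
  rw [show ((m : ℕ) : ℤ) + ((c : ℤ) - m) = (c : ℤ) by ring] at e
  rw [← e]
  exact BettiUniverse.hodgeConjectureFor_tensor_of_offMiddle_algebraic_iff_finrank_le μ hHD hY hZ hYZ hHCY hHCZ hoddY hevenY hoddZ hevenZ hmn hab

/-- **The square: `HC(X × X) ⟺ dim_ℚ End_HS(HⁿX) ≤ dim_ℂ ⟨actions on Hⁿ(X;ℂ) of the rational algebraic classes of H^{2n}(X × X)⟩`** for `X` off-middle algebraic of dimension `n` with `HC(X)` — «`End_HS(HⁿX)` is
generated by algebraic correspondences» as an equivalence (g29-#11 §2 was `⟸` with an explicit independent family). [cite: VoisinHodgeI2002, §11.3.3 Thm. 11.38–11.40, Lemma 11.41 and pp. 286–287]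
[cite: Voisin2025, §3.2.1 (12)–(14), Prop. 3.8 and Cor. 3.9] [cite: Deligne2000, §1] -/
theorem BettiUniverse.hodgeConjectureFor_tensor_self_of_offMiddle_algebraic_iff_finrank_end_le (hHD : exists_isReal_hodgeModel) (hX : IsSmoothProjective n X) (hXX : IsSmoothProjective d (X ⊗ X))
    (hHC : HodgeConjectureFor n X) (hodd : ∀ k, Odd k → k ≠ n → Module.finrank ℚ (bettiCohomology X k) = 0) (heven : ∀ p, 2 * p ≠ n → (BettiUniverse.hodge hHD hX (2 * p)).hodgeClasses p = ⊤) :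
    HodgeConjectureFor d (X ⊗ X) ↔
      Module.finrank ℚ (HodgeStructure.Hom (BettiUniverse.hodge hHD hX n) (BettiUniverse.hodge hHD hX n)) ≤
        Module.finrank ℂ ↥(Submodule.span ℂ ((fun γ ↦ corrAction μ hX hX (rfl : n + 2 * n = n + 2 * n) (ofRatClass (ComplexPoints (X ⊗ X)) (2 * n) γ)) ''
          {γ : bettiCohomology (X ⊗ X) (2 * n) | ofRatClass (ComplexPoints (X ⊗ X)) (2 * n) γ ∈ algebraicClasses (X ⊗ X) n})) := by
  rw [← BettiUniverse.finrank_hodgeClasses_tensor_hodge_eq_finrank_hom hHD hX hX n]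
  exact BettiUniverse.hodgeConjectureFor_tensor_of_offMiddle_algebraic_iff_finrank_le μ hHD hX hX hXX hHC hHC hodd heven hodd heven (two_mul n).symm rfl

end Criteria

end Literature.AlgebraicGeometry.HodgeTheory

/-! ### §5 Odd-dimensional smooth hypersurfaces -/

namespace Literature.AlgebraicGeometry.Motives.IsSmoothHypersurface

open Literature.AlgebraicGeometry.Motives
open Literature.AlgebraicGeometry.HodgeTheory

variable {m n e e' : ℕ} {Y Y' : SchemeOver ℂ}

/-- **`HC(Y × Y) ⟺ dim_ℚ End_HS(HᵐY) ≤ dim_ℂ ⟨actions on Hᵐ(Y;ℂ) of the algebraic self-correspondences of Y⟩`** for a smooth hypersurface `Y` of ODD dimension `m` (off-middle algebraic with `HC`, Cor. 1.24/1.25).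
[cite: VoisinHodgeII2003, §1.2.3 Cor. 1.24 and Cor. 1.25] [cite: VoisinHodgeI2002, §11.3.3 Lemma 11.41 and pp. 286–287] [cite: Deligne2000, §1] -/
theorem hodgeConjectureFor_tensor_self_iff_finrank_end_le_of_odd [HodgeTensorFacts.{0, 0}] (hY : IsSmoothHypersurface m e Y) (μ : OrientationFamily) (hHD : exists_isReal_hodgeModel) (hm : Odd m) :
    HodgeConjectureFor (m + m) (Y ⊗ Y) ↔
      Module.finrank ℚ (HodgeStructure.Hom (BettiUniverse.hodge hHD hY.1 m) (BettiUniverse.hodge hHD hY.1 m)) ≤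
        Module.finrank ℂ ↥(Submodule.span ℂ ((fun γ ↦ corrAction μ hY.1 hY.1 (rfl : m + 2 * m = m + 2 * m) (ofRatClass (ComplexPoints (Y ⊗ Y)) (2 * m) γ)) ''
          {γ : bettiCohomology (Y ⊗ Y) (2 * m) | ofRatClass (ComplexPoints (Y ⊗ Y)) (2 * m) γ ∈ algebraicClasses (Y ⊗ Y) m})) :=
  BettiUniverse.hodgeConjectureFor_tensor_self_of_offMiddle_algebraic_iff_finrank_end_le μ hHD hY.1 (hY.1.tensor_holds hY.1) (hY.hodgeConjectureFor_of_odd hHD hm)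
    (fun _ hk hkm ↦ hY.finrank_bettiCohomology_eq_zero_of_odd hk hkm) (fun _ hp ↦ hY.hodgeClasses_hodge_eq_top_of_two_mul_ne hHD hY.1 hp)

/-- **`HC(Y × Y') ⟺ dim_ℚ Hom_HS(HᵐY, HⁿY'(c − m)) ≤ dim_ℂ ⟨actions Hⁿ(Y';ℂ) → Hᵐ(Y;ℂ) of the algebraic classes of H^{2c}(Y × Y')⟩`** for two smooth hypersurfaces of ODD dimensions `m`, `n` (`m + n = 2c`).
[cite: VoisinHodgeII2003, §1.2.3 Cor. 1.24 and Cor. 1.25] [cite: VoisinHodgeI2002, §11.3.3 Lemma 11.41 and pp. 286–287] [cite: Deligne2000, §1] -/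
theorem hodgeConjectureFor_tensor_hypersurface_iff_finrank_hom_le_of_odd_of_odd [HodgeTensorFacts.{0, 0}] (hY : IsSmoothHypersurface m e Y) (hY' : IsSmoothHypersurface n e' Y') (μ : OrientationFamily)
    (hHD : exists_isReal_hodgeModel) (hm : Odd m) (hn : Odd n) {c : ℕ} (hmn : m + n = 2 * c) (hab : n + 2 * c = m + 2 * n) (hs : (n : ℤ) - 2 * ((c : ℤ) - m) = m) :
    HodgeConjectureFor (m + n) (Y ⊗ Y') ↔
      Module.finrank ℚ (HodgeStructure.Hom (BettiUniverse.hodge hHD hY.1 m) (((BettiUniverse.hodge hHD hY'.1 n).tateTwist ((c : ℤ) - m)).cast hs)) ≤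
        Module.finrank ℂ ↥(Submodule.span ℂ ((fun γ ↦ corrAction μ hY.1 hY'.1 hab (ofRatClass (ComplexPoints (Y ⊗ Y')) (2 * c) γ)) ''
          {γ : bettiCohomology (Y ⊗ Y') (2 * c) | ofRatClass (ComplexPoints (Y ⊗ Y')) (2 * c) γ ∈ algebraicClasses (Y ⊗ Y') c})) :=
  BettiUniverse.hodgeConjectureFor_tensor_of_offMiddle_algebraic_iff_finrank_hom_le μ hHD hY.1 hY'.1 (hY.1.tensor_holds hY'.1) (hY.hodgeConjectureFor_of_odd hHD hm) (hY'.hodgeConjectureFor_of_odd hHD hn)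
    (fun _ hk hkm ↦ hY.finrank_bettiCohomology_eq_zero_of_odd hk hkm) (fun _ hp ↦ hY.hodgeClasses_hodge_eq_top_of_two_mul_ne hHD hY.1 hp)
    (fun _ hk hkn ↦ hY'.finrank_bettiCohomology_eq_zero_of_odd hk hkn) (fun _ hp ↦ hY'.hodgeClasses_hodge_eq_top_of_two_mul_ne hHD hY'.1 hp) hmn hab hs

end Literature.AlgebraicGeometry.Motives.IsSmoothHypersurface

end
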